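import Mathlib
import Summits.CriticalPhenomena.CardyFormulaZ2.Theorems.CardyFlipRussoSquareFromVoronoiHubDefs
import Summits.CriticalPhenomena.CardyFormulaZ2.Theorems.CardyFlipRussoSquareFromVoronoiHubFaithfulPart2
import Summits.CriticalPhenomena.CardyFormulaZ2.Theorems.CardyFlipRussoSquareFromVoronoiHubFaithfulPart4
import Summits.CriticalPhenomena.CardyFormulaZ2.Theorems.CardyFlipRussoSquareFromVoronoiHubFaithfulPart5
import Summits.CriticalPhenomena.CardyFormulaZ2.Theorems.CardyFlipRussoSquareFromVoronoiHubFaithfulPart6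
import Summits.CriticalPhenomena.CardyFormulaZ2.Theorems.CardyFlipRussoSquareFromVoronoiHubFaithfulPart7
import Summits.CriticalPhenomena.CardyFormulaZ2.Theorems.CardyFlipRussoSquareFromVoronoiHubFaithfulPart8
import Summits.CriticalPhenomena.CardyFormulaZ2.Theorems.CardyFlipRussoSquareFromVoronoiHubSandwichPart1
import Literature.Probability.Percolation.VoronoiCrossing
import Literature.Probability.Percolation.SitePaths
import HarnessLib

/-!
# Stub `stub_upperExclusion` of line `Sketch` (r2 k4, card `poissonised-chessboard`), crux `SquareFromVoronoiHub`

The DETERMINISTIC upper exclusion (S5) of the chessboard-endpoint sandwich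
(stmt-CriticalPhenomena-6434, route `CardyFlipRusso`; lead c4 skeleton
`Cruxes/SquareFromVoronoiHub/Lines/Sketch.lean`): a black `G_s` lattice crossing of `R` at mesh
`δ` (the crude event `crudeCrossing R δ` for the coins `ω₂`) and a WHITE continuum crossing `P₀`
of the conjugate (upper perturbed) rectangle `R₂` cannot coexist, granted the crossing clause of
`upperMargins R R₂` at a margin `r ≥ 2δ`.

Setting.  An abstract block map `β : ℂ → G_s` at mesh `δ` with three axioms: (rad) every point is
within `3δ/5` of the position `δ · zGs (β p)` of its block; (sep) points at distance `≤ δ/4` have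
equal-or-adjacent blocks; (spine) every point of the segment between the positions of two
equal-or-adjacent sites `u`, `v` lies in block `u` or block `v`.  Nuclei `K ⊆ ℂ` are coloured by
the coins (black iff `β p ∈ ω₂`), `δ/16`-dense on `V ⊇ closure R₂`, with a white nucleus.  The
first hypothesis is the block-chain lemma (registered separately as `stub_blockChain`): a black
piece of a path in `V` is shadowed within `7δ/10` by an open `G_s`-chain of black blocks.

Proof (twin of K1's `false_of_block_of_whiteTube`).
* BLACK SPINE: the polygonal interpolation `Q` of the open lattice crossing (Part 4
  `exists_joinedIn_of_mem_crudeCrossing`, segments between equal-or-adjacent open sites of `Ω`,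
  of length `≤ δ` by Part 8 `dist_le_of_Gs_adj`) runs within `δ ≤ r` of `Ω` from within `2δ` of
  `(ab)` to within `2δ` of `(cd)`.
* WHITE SPINE: the block-chain lemma applied to the complementary coins `ω₂ᶜ` along `P₀` gives an
  open chain of WHITE blocks within `7δ/10` of `P₀`, from within `7δ/10` of `p ∈ R₂.arc 0` to
  within `7δ/10` of `q ∈ R₂.arc 2`; its polygonal interpolation `P` (Part 4 `joinedIn_of_pathIn`)
  stays within `δ + 7δ/10 ≤ 2δ ≤ r` of `closure R₂`.
* The crossing clause makes `P` and `Q` meet at a point `X` lying on a segment between two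
  equal-or-adjacent WHITE sites and on a segment between two equal-or-adjacent BLACK sites; by
  (spine) the block `β X` is then both white and black.

Sources: Bollobás–Riordan, *Percolation* (2006), Ch. 7 proof of Thm. 2 (p. 199) and Ch. 8 §8.3;
the card `Cruxes/SquareFromVoronoiHub/Ideas/poissonised-chessboard.md`.
-/

noncomputable section

open scoped Topology
open Filter Set MeasureTheory Metric
open Literature.Analysis.FunctionSpaces (PointConfig IsPoissonPointProcess)
open Literature.Probability.RandomPlanarGeometry (ConformalRectangle cardyFunction crossRatio)
open Literature.Probability.Percolation (SiteConfig sitePercolation half voronoiCrossing blackRegion PathIn)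
open Summit.CriticalPhenomena.CardyFormulaZ2.Cruxes.SquareFromVoronoiHub.VoronoiBlocks
  (zGs Gs crudeCrossing siteCrossingProb voronoiCrossingProb squareFromVoronoiHub_iff)
open Summit.CriticalPhenomena.CardyFormulaZ2.Cruxes.SquareFromVoronoiHub.VoronoiBlocks.Faithful

namespace Summit.CriticalPhenomena.CardyFormulaZ2.Cruxes.SquareFromVoronoiHub.PoissonisedChessboard

/-- A point of the segment between the positions of two equal-or-`G_s`-adjacent sites of
`δ • G_s` (`δ ≥ 0`) is within `δ` of the first endpoint (`dist_le_of_Gs_adj`). [folklore] -/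
theorem dist_le_of_mem_segment_of_eq_or_adj {δ : ℝ} (hδ : 0 ≤ δ) {u v : (ℤ × ℤ) ⊕ (ℤ × ℤ)}
    (huv : u = v ∨ Gs.Adj u v) {z : ℂ}
    (hz : z ∈ segment ℝ ((δ : ℂ) * zGs u) ((δ : ℂ) * zGs v)) :
    dist z ((δ : ℂ) * zGs u) ≤ δ := by
  have hd : dist ((δ : ℂ) * zGs u) ((δ : ℂ) * zGs v) ≤ δ := by
    rcases huv with rfl | h
    · rw [dist_self]; exact hδ
    · exact dist_le_of_Gs_adj hδ h
  have hsum := dist_add_dist_of_mem_segment hz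
  rw [dist_comm]
  linarith [dist_nonneg (x := z) (y := (δ : ℂ) * zGs v)]

/-- **S5 — the deterministic upper exclusion (registered stub `stub_upperExclusion`).**  Granted
the block-chain lemma (first hypothesis, = `stub_blockChain`), an abstract block map `β` at mesh
`δ > 0` with the axioms (rad), (sep), (spine), nuclei `K` coloured by the coins `ω₂`,
`δ/16`-dense on `V ⊇ closure R₂` and with a white nucleus, and the crossing clause of
`upperMargins R R₂` at margin `r ≥ 2δ`: a crude block crossing `ω₂ ∈ crudeCrossing R δ` and a
white continuum crossing `P₀ ⊆ closure R₂` of `R₂` from `R₂.arc 0` to `R₂.arc 2` cannot coexist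
(the black polygonal spine of the lattice crossing meets the white polygonal spine of the block
chain shadowing `P₀`; at the meeting point (spine) puts one block in `ω₂` and in `ω₂ᶜ`).
[cite: BollobasRiordan2006, Ch. 7 proof of Thm. 2 p. 199] -/
theorem stub_upperExclusion : (∀ {δ : ℝ}, 0 < δ → ∀ (β : ℂ → (ℤ × ℤ) ⊕ (ℤ × ℤ)),
      (∀ p : ℂ, dist p ((δ : ℂ) * zGs (β p)) ≤ 3 / 5 * δ) →
      (∀ p q : ℂ, dist p q ≤ δ / 4 → β p = β q ∨ Gs.Adj (β p) (β q)) →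
      ∀ (ω₂ : Set ((ℤ × ℤ) ⊕ (ℤ × ℤ))) (K V : Set ℂ),
      (∀ z ∈ V, ∃ p ∈ K, dist z p < δ / 16) → {p | p ∈ K ∧ β p ∈ ω₂}.Nonempty →
      ∀ {x y : ℂ} (γ : Path x y) (a b : ℝ), 0 ≤ a → a ≤ b → b ≤ 1 →
      (∀ t ∈ Icc a b, γ.extend t ∈ V) →
      (∀ t ∈ Icc a b, γ.extend t ∈ blackRegion {p | p ∈ K ∧ β p ∈ ω₂} {p | p ∈ K ∧ β p ∉ ω₂}) →
      ∃ u w : (ℤ × ℤ) ⊕ (ℤ × ℤ), dist (γ.extend a) ((δ : ℂ) * zGs u) ≤ 7 / 10 * δ ∧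
        dist (γ.extend b) ((δ : ℂ) * zGs w) ≤ 7 / 10 * δ ∧
        PathIn Gs ({v | ∃ t ∈ Icc a b, dist (γ.extend t) ((δ : ℂ) * zGs v) ≤ 7 / 10 * δ} ∩ ω₂) u w) →
    ∀ (R R₂ : ConformalRectangle) {δ : ℝ}, 0 < δ → ∀ (β : ℂ → (ℤ × ℤ) ⊕ (ℤ × ℤ)),
      (∀ p : ℂ, dist p ((δ : ℂ) * zGs (β p)) ≤ 3 / 5 * δ) →
      (∀ p q : ℂ, dist p q ≤ δ / 4 → β p = β q ∨ Gs.Adj (β p) (β q)) →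
      (∀ u v : (ℤ × ℤ) ⊕ (ℤ × ℤ), u = v ∨ Gs.Adj u v →
        ∀ z ∈ segment ℝ ((δ : ℂ) * zGs u) ((δ : ℂ) * zGs v), β z = u ∨ β z = v) →
      ∀ (ω₂ : Set ((ℤ × ℤ) ⊕ (ℤ × ℤ))) (K V : Set ℂ),
      (∀ z ∈ V, ∃ p ∈ K, dist z p < δ / 16) → closure R₂.carrier ⊆ V →
      {p | p ∈ K ∧ β p ∉ ω₂}.Nonempty →
      ∀ {r : ℝ}, (∀ (p₁ p₃ q₀ q₂ : ℂ) (P : Path p₁ p₃) (Q : Path q₀ q₂),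
        infDist p₁ (R₂.arc 0) ≤ r → infDist p₃ (R₂.arc 2) ≤ r →
        (∀ t, infDist (P t) (closure R₂.carrier) ≤ r) →
        infDist q₀ (R.arc 0) ≤ r → infDist q₂ (R.arc 2) ≤ r → (∀ s, infDist (Q s) R.carrier ≤ r) →
        ∃ t s, P t = Q s) →
      2 * δ ≤ r → ω₂ ∈ crudeCrossing R δ →
      ∀ {p q : ℂ} (P₀ : Path p q), p ∈ R₂.arc 0 → q ∈ R₂.arc 2 → (∀ t, P₀ t ∈ closure R₂.carrier) →
      (∀ t, P₀ t ∈ blackRegion {p | p ∈ K ∧ β p ∉ ω₂} {p | p ∈ K ∧ β p ∈ ω₂}) →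
      False := by
  intro hchain R R₂ δ hδ β hrad hsep hspine ω₂ K V hKV hV hWne r hcross hδr hblock p q P₀ hp hq
    hP₀ hwhite
  -- (1) the black spine: polygonal interpolation of the open lattice crossing of `Ω`
  set Kb : Set ℂ := {z | ∃ v v' : (ℤ × ℤ) ⊕ (ℤ × ℤ), v ∈ ω₂ ∧ v' ∈ ω₂ ∧
    (δ : ℂ) * zGs v ∈ R.carrier ∧ (v = v' ∨ Gs.Adj v v') ∧
    z ∈ segment ℝ ((δ : ℂ) * zGs v) ((δ : ℂ) * zGs v')}
  have hmemb : ∀ v ∈ ω₂, (δ : ℂ) * zGs v ∈ R.carrier → (δ : ℂ) * zGs v ∈ Kb :=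
    fun v hv hvΩ => ⟨v, v, hv, hv, hvΩ, Or.inl rfl, left_mem_segment ℝ _ _⟩
  have hadjb : ∀ v ∈ ω₂, ∀ v' ∈ ω₂, (δ : ℂ) * zGs v ∈ R.carrier →
      (δ : ℂ) * zGs v' ∈ R.carrier → Gs.Adj v v' →
      JoinedIn Kb ((δ : ℂ) * zGs v) ((δ : ℂ) * zGs v') :=
    fun v hv v' hv' hvΩ _ hvv' =>
      JoinedIn.of_segment_subset fun z hz => ⟨v, v', hv, hv', hvΩ, Or.inr hvv', hz⟩
  obtain ⟨q₀, q₂, hq₀, hq₂, hJb⟩ := exists_joinedIn_of_mem_crudeCrossing R hblock hmemb hadjb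
  have hQ : ∀ s, hJb.somePath s ∈ Kb := fun s => hJb.somePath_mem s
  -- (2) the white chain along `P₀` (block-chain lemma for the complementary coins `ω₂ᶜ`)
  have hB : {p | p ∈ K ∧ β p ∉ ω₂ᶜ} = {p | p ∈ K ∧ β p ∈ ω₂} := by
    ext
    simp
  obtain ⟨u', w', hu', hw', hpath⟩ := hchain hδ β hrad hsep ω₂ᶜ K V hKV hWne P₀ 0 1 le_rfl
    zero_le_one le_rfl
    (fun t ht => hV (by rw [Path.extend_apply P₀ ht]; exact hP₀ _))
    (fun t ht => by rw [hB, Path.extend_apply P₀ ht]; exact hwhite _)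
  rw [Path.extend_zero] at hu'
  rw [Path.extend_one] at hw'
  -- its polygonal interpolation, the white spine
  set A : Set ((ℤ × ℤ) ⊕ (ℤ × ℤ)) :=
    {v | ∃ t ∈ Icc (0 : ℝ) 1, dist (P₀.extend t) ((δ : ℂ) * zGs v) ≤ 7 / 10 * δ}
  set Kw : Set ℂ := {z | ∃ v v' : (ℤ × ℤ) ⊕ (ℤ × ℤ), v ∈ A ∩ ω₂ᶜ ∧ v' ∈ A ∩ ω₂ᶜ ∧
    (v = v' ∨ Gs.Adj v v') ∧ z ∈ segment ℝ ((δ : ℂ) * zGs v) ((δ : ℂ) * zGs v')}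
  have hJw : JoinedIn Kw ((δ : ℂ) * zGs u') ((δ : ℂ) * zGs w') :=
    joinedIn_of_pathIn (K := Kw) (fun v => (δ : ℂ) * zGs v)
      (fun v hv => ⟨v, v, hv, hv, Or.inl rfl, left_mem_segment ℝ _ _⟩)
      (fun v hv v' hv' hvv' =>
        JoinedIn.of_segment_subset fun z hz => ⟨v, v', hv, hv', Or.inr hvv', hz⟩) hpath
  have hP : ∀ t, hJw.somePath t ∈ Kw := fun t => hJw.somePath_mem t
  -- (3) the crossing clause: the two spines meet
  have h7 : 7 / 10 * δ ≤ r := by linarith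
  obtain ⟨t, s, hts⟩ := hcross _ _ q₀ q₂ hJw.somePath hJb.somePath
    ((infDist_le_dist_of_mem hp).trans (by rw [dist_comm]; exact hu'.trans h7))
    ((infDist_le_dist_of_mem hq).trans (by rw [dist_comm]; exact hw'.trans h7))
    (fun t => by
      obtain ⟨v, v', ⟨⟨t₀, ht₀, hd₀⟩, -⟩, -, hvv', hz⟩ := hP t
      have h1 : dist (hJw.somePath t) ((δ : ℂ) * zGs v) ≤ δ :=
        dist_le_of_mem_segment_of_eq_or_adj hδ.le hvv' hz
      have h2 : P₀.extend t₀ ∈ closure R₂.carrier := by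
        rw [Path.extend_apply P₀ ht₀]
        exact hP₀ _
      have h3 : dist ((δ : ℂ) * zGs v) (P₀.extend t₀) ≤ 7 / 10 * δ := by
        rw [dist_comm]
        exact hd₀
      calc infDist (hJw.somePath t) (closure R₂.carrier)
          ≤ dist (hJw.somePath t) (P₀.extend t₀) := infDist_le_dist_of_mem h2
        _ ≤ dist (hJw.somePath t) ((δ : ℂ) * zGs v) + dist ((δ : ℂ) * zGs v) (P₀.extend t₀) :=
          dist_triangle _ _ _
        _ ≤ r := by linarith)
    (hq₀.trans hδr) (hq₂.trans hδr)
    (fun s => by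
      obtain ⟨v, v', -, -, hvΩ, hvv', hz⟩ := hQ s
      exact (infDist_le_dist_of_mem hvΩ).trans
        ((dist_le_of_mem_segment_of_eq_or_adj hδ.le hvv' hz).trans (by linarith)))
  -- (4) the meeting point lies on a white segment and on a black segment: (spine) twice
  obtain ⟨v, v', ⟨-, hvω⟩, ⟨-, hv'ω⟩, hvv', hz⟩ := hP t
  obtain ⟨b, b', hbω, hb'ω, -, hbb', hzb⟩ := hQ s
  rw [← hts] at hzb
  have hwX : β (hJw.somePath t) ∉ ω₂ := by
    rcases hspine v v' hvv' _ hz with h | h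
    · rw [h]; exact hvω
    · rw [h]; exact hv'ω
  have hbX : β (hJw.somePath t) ∈ ω₂ := by
    rcases hspine b b' hbb' _ hzb with h | h
    · rw [h]; exact hbω
    · rw [h]; exact hb'ω
  exact hwX hbX

end Summit.CriticalPhenomena.CardyFormulaZ2.Cruxes.SquareFromVoronoiHub.PoissonisedChessboard

end
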